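import Literature.NumberTheory.LFunctions.NoRealZeroCertificateReplayTableB
import HarnessLib

/-!
# Kernel replay of the Lu–Zaman–Zhao certificates: verifying deep prime tables by trial division over `table15`

Topic `Literature/NumberTheory/LFunctions`. The table verifier `tableCheck` of `NoRealZeroCertificateReplay.lean`
tests primality of each listed `p` by trial division over ALL `d ≥ 2` (`isPrimeC`, `√p` kernel steps). For the deep
tables of the heavy tiers (`p` up to `5.9·10⁶`, `√p ≈ 2 400`) this dominates the kernel cost (measured 2026-08-26:
`≈ 0.24 ms` per trial step against `≈ 75 ms` for the three interval enclosures of an entry). This file replaces it by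
trial division over the PRIMES of the verified table `table15` (`p < 2^15`, `NoRealZeroCertificateReplayTableA/B.lean`):
`π(√p) ≤ 360` steps for every `p < 2^30`.

* `noDivT n T`, `isPrimeT T n` — trial division by the primes of a sorted prime table `T`; sound for `n < B²` when `T`
  holds EVERY prime `< B` (`CompleteBelow T B`): `prime_of_isPrimeT`;
* `hasFactorFrom`, `completeWalk`, **`completeBelow_of_completeWalk`** — a kernel check that a sorted table misses no
  prime below `B` (walk `n = 2, …, B − 1`: pop the table at its primes, exhibit a divisor at every other `n`), and
  **`table15_complete : CompleteBelow table15 32768`** (kernel, one pass);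
* `entryCheckT`, `tableCheckT`, **`entryValid_of_tableCheckT`** — the entry/table verifier with `isPrimeT table15` in
  place of `isPrimeC`, same enclosures (`prow`), same meaning (`EntryValid`), valid for entries `p < 2^30`;
  `entryValid_of_chunkT` (the `match rI` form used by table files).

Definitions + theorems; nothing deep is evaluated here except `table15_complete` (≈ 3·10⁴ cheap kernel steps).

## References

* W. Lu, A. Zaman, K. Zhao, *Dirichlet L-functions of quadratic characters have no exceptional
  zeros for moduli up to 10¹⁰*, Math. Comp. (2026), arXiv:2602.03626, §2.2 and (2.3). [LuZamanZhao2026]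
-/

namespace Literature.NumberTheory.LFunctions
namespace LuZamanZhao2026
namespace Replay

open Literature.Analysis.ValidatedNumerics Literature.Analysis.ValidatedNumerics.NumericsMP

/-! ## Trial division by the primes of a table -/

/-- No table prime `q` with `q² ≤ n` divides `n` (the table is walked in order and the walk stops at the first
`q² > n`). [folklore] -/
def noDivT (n : ℕ) : List PRow → Bool
  | [] => true
  | e :: T => if n < e.p * e.p then true else if n % e.p = 0 then false else noDivT n T

/-- Primality by trial division over the table primes. [folklore] -/
def isPrimeT (T : List PRow) (n : ℕ) : Bool := decide (2 ≤ n) && noDivT n T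

/-- **Completeness of a prime table below `B`**: every prime `< B` is listed (the property of the prime table
of Lu–Zaman–Zhao's §2.2 that trial division by it relies on). [cite: LuZamanZhao2026, §2.2] -/
def CompleteBelow (T : List PRow) (B : ℕ) : Prop := ∀ q : ℕ, q.Prime → q < B → q ∈ T.map PRow.p

/-- Soundness of the walk: on a sorted table, no listed prime `q` with `q² ≤ n` divides `n`. [folklore] -/
private theorem noDivT_sound {n : ℕ} : ∀ {T : List PRow}, (T.map PRow.p).Pairwise (· < ·) → noDivT n T = true →
    ∀ e ∈ T, e.p * e.p ≤ n → ¬ e.p ∣ n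
  | [], _, _ => by simp
  | e :: T, hs, h => by
    rw [List.map_cons, List.pairwise_cons] at hs
    unfold noDivT at h
    intro e' he' hle hdvd
    by_cases h1 : n < e.p * e.p
    · -- the walk stopped: every listed prime from here on is too large
      rcases List.mem_cons.1 he' with rfl | hm
      · omega
      · have hlt : e.p < e'.p := hs.1 e'.p (List.mem_map.2 ⟨e', hm, rfl⟩)
        have : e.p * e.p < e'.p * e'.p := Nat.mul_lt_mul'' hlt hlt
        omega
    rw [if_neg h1] at h
    by_cases h2 : n % e.p = 0
    · rw [if_pos h2] at h; exact Bool.false_ne_true h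
    rw [if_neg h2] at h
    rcases List.mem_cons.1 he' with rfl | hm
    · exact h2 (Nat.mod_eq_zero_of_dvd hdvd)
    · exact noDivT_sound hs.2 h e' hm hle hdvd

/-- **`isPrimeT` is sound below `B²` over a valid table complete below `B`.** [folklore] -/
private theorem prime_of_isPrimeT {T : List PRow} (hT : TableValid T) {B : ℕ} (hc : CompleteBelow T B) {n : ℕ}
    (hn : n < B * B) (h : isPrimeT T n = true) : n.Prime := by
  unfold isPrimeT at h
  rw [Bool.and_eq_true, decide_eq_true_eq] at h
  obtain ⟨h2, hwalk⟩ := h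
  rw [Nat.prime_def_le_sqrt]
  refine ⟨h2, fun m hm2 hms hmdvd => ?_⟩
  -- a prime factor `q` of `m` divides `n` and has `q² ≤ n`
  obtain ⟨q, hq, hqm⟩ := Nat.exists_prime_and_dvd (show m ≠ 1 by omega)
  have hqn : q ∣ n := dvd_trans hqm hmdvd
  have hqle : q ≤ m := Nat.le_of_dvd (by omega) hqm
  have hmm : m * m ≤ n := Nat.le_sqrt.1 hms
  have hqq : q * q ≤ n := le_trans (Nat.mul_le_mul hqle hqle) hmm
  -- `q < B`, so `q` is listed
  have hqB : q < B := by
    by_contra hge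
    rw [not_lt] at hge
    have : B * B ≤ q * q := Nat.mul_le_mul hge hge
    omega
  obtain ⟨e, he, hep⟩ := List.mem_map.1 (hc q hq hqB)
  exact noDivT_sound hT.2 hwalk e he (by rw [hep]; exact hqq) (by rw [hep]; exact hqn)

/-! ## A kernel completeness check -/

/-- A divisor witness: some `d' ≥ d` with `d'² ≤ n` divides `n` (fuel-bounded). [folklore] -/
def hasFactorFrom (n : ℕ) : ℕ → ℕ → Bool
  | 0, _ => false
  | fuel + 1, d => if n < d * d then false else if n % d = 0 then true else hasFactorFrom n fuel (d + 1)

/-- `hasFactorFrom` is sound: a witness `m ≥ d`, `m² ≤ n`, `m ∣ n`. [folklore] -/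
private theorem hasFactorFrom_sound {n : ℕ} : ∀ {fuel d : ℕ}, hasFactorFrom n fuel d = true →
    ∃ m, d ≤ m ∧ m * m ≤ n ∧ m ∣ n
  | 0, _, h => by simp [hasFactorFrom] at h
  | fuel + 1, d, h => by
    unfold hasFactorFrom at h
    by_cases h1 : n < d * d
    · rw [if_pos h1] at h; exact absurd h Bool.false_ne_true
    rw [if_neg h1] at h
    by_cases h2 : n % d = 0
    · exact ⟨d, le_rfl, by omega, Nat.dvd_of_mod_eq_zero h2⟩
    · rw [if_neg h2] at h
      obtain ⟨m, hdm, hmm, hmd⟩ := hasFactorFrom_sound h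
      exact ⟨m, by omega, hmm, hmd⟩

/-- A number `≥ 2` with a divisor `m`, `2 ≤ m`, `m² ≤ n`, is not prime. [folklore] -/
private theorem not_prime_of_hasFactorFrom {n : ℕ} (h : hasFactorFrom n n 2 = true) : ¬ n.Prime := by
  obtain ⟨m, h2m, hmm, hmd⟩ := hasFactorFrom_sound h
  intro hp
  rcases (Nat.dvd_prime hp).1 hmd with h1 | hmn
  · omega
  · subst hmn
    have : 2 * m ≤ m * m := Nat.mul_le_mul_right m h2m
    have h4 : m * m ≤ m := hmm
    omega

/-- **The completeness walk**: for `n, n+1, …` (`fuel` numbers) either `n` heads the remaining prime list (pop it)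
or `n` has a divisor witness. [folklore] -/
def completeWalk : List ℕ → ℕ → ℕ → Bool
  | _, _, 0 => true
  | [], n, fuel + 1 => hasFactorFrom n n 2 && completeWalk [] (n + 1) fuel
  | p :: ps, n, fuel + 1 =>
    if p = n then completeWalk ps (n + 1) fuel else hasFactorFrom n n 2 && completeWalk (p :: ps) (n + 1) fuel

/-- Soundness of the walk: every prime `q` with `n ≤ q < n + fuel` is in the list. [folklore] -/
private theorem completeWalk_sound : ∀ (fuel : ℕ) (ps : List ℕ) (n : ℕ), completeWalk ps n fuel = true →
    ∀ q, n ≤ q → q < n + fuel → q.Prime → q ∈ ps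
  | 0, ps, n, _ => by intro q h1 h2; omega
  | fuel + 1, [], n, h => by
    intro q h1 h2 hq
    unfold completeWalk at h
    rw [Bool.and_eq_true] at h
    rcases Nat.eq_or_lt_of_le h1 with rfl | hlt
    · exact absurd hq (not_prime_of_hasFactorFrom h.1)
    · exact completeWalk_sound fuel [] (n + 1) h.2 q hlt (by omega) hq
  | fuel + 1, p :: ps, n, h => by
    intro q h1 h2 hq
    unfold completeWalk at h
    by_cases hpn : p = n
    · rw [if_pos hpn] at h
      rcases Nat.eq_or_lt_of_le h1 with rfl | hlt
      · rw [hpn]; exact List.mem_cons_self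
      · exact List.mem_cons_of_mem _ (completeWalk_sound fuel ps (n + 1) h q hlt (by omega) hq)
    · rw [if_neg hpn, Bool.and_eq_true] at h
      rcases Nat.eq_or_lt_of_le h1 with rfl | hlt
      · exact absurd hq (not_prime_of_hasFactorFrom h.1)
      · exact completeWalk_sound fuel (p :: ps) (n + 1) h.2 q hlt (by omega) hq

/-- **Completeness from the kernel walk**: if `completeWalk (T.map p) 2 (B − 2) = true` then `T` lists every prime
`< B`. [folklore] -/
private theorem completeBelow_of_completeWalk {T : List PRow} {B : ℕ}
    (h : completeWalk (T.map PRow.p) 2 (B - 2) = true) : CompleteBelow T B := by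
  intro q hq hqB
  exact completeWalk_sound (B - 2) _ 2 h q hq.two_le (by have := hq.two_le; omega) hq

set_option maxHeartbeats 0 in
/-- The completeness walk for `table15` below `2^15`, in the kernel. [cite: LuZamanZhao2026, §2.2 and (2.3)] -/
theorem table15_completeWalk : completeWalk (table15.map PRow.p) 2 (32768 - 2) = true := by
  decide +kernel

/-- **`table15` lists every prime below `2^15`.** [cite: LuZamanZhao2026, §2.2 and (2.3)] -/
theorem table15_complete : CompleteBelow table15 32768 :=
  completeBelow_of_completeWalk table15_completeWalk

/-! ## The entry / table verifier over `table15` -/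

/-- Kernel check of ONE literal table entry with primality by `isPrimeT table15`: `p < 2^30`, `p` prime, and the
three stored naturals are below the kernel's own lower bounds (`prow`). [cite: LuZamanZhao2026, §2.2 and (2.3)] -/
def entryCheckT (R : MI) (e : PRow) : Bool :=
  decide (e.p < 1073741824) && isPrimeT table15 e.p &&
    match prow R e.p with
    | some (A, B, C) =>
      decide ((e.tPlus : ℤ) ≤ A.lo) && decide ((e.tZero : ℤ) ≤ B.lo) && decide ((e.tMinus : ℤ) ≤ C.lo)
    | none => false

/-- Kernel check of a literal table chunk with `entryCheckT`. [cite: LuZamanZhao2026, §2.2 and (2.3)] -/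
def tableCheckT (R : MI) : List PRow → Bool
  | [] => true
  | e :: T => entryCheckT R e && tableCheckT R T

/-- A `T`-checked entry is valid. [cite: LuZamanZhao2026, §2.2 and (2.3)] -/
theorem entryValid_of_entryCheckT {R : MI} (hR : MI.mem SC (rOf 1.6) R) {e : PRow}
    (h : entryCheckT R e = true) : EntryValid e := by
  unfold entryCheckT at h
  rw [Bool.and_eq_true, Bool.and_eq_true, decide_eq_true_eq] at h
  obtain ⟨⟨hlt, hpr⟩, h2⟩ := h
  have hprime : e.p.Prime :=
    prime_of_isPrimeT table15_valid table15_complete (B := 32768) (by norm_num at hlt ⊢; omega) hpr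
  refine ⟨hprime, ?_⟩
  split at h2
  · rename_i A B C hABC
    simp only [Bool.and_eq_true, decide_eq_true_eq] at h2
    obtain ⟨⟨ha, hb⟩, hc⟩ := h2
    obtain ⟨hA, hB, hC⟩ := prow_sound hR hprime.two_le hABC
    refine ⟨?_, ?_, ?_⟩
    · calc (e.tPlus : ℝ) = ((e.tPlus : ℤ) : ℝ) := by push_cast; rfl
        _ ≤ (A.lo : ℝ) := by exact_mod_cast ha
        _ ≤ _ := hA.1
    · calc (e.tZero : ℝ) = ((e.tZero : ℤ) : ℝ) := by push_cast; rfl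
        _ ≤ (B.lo : ℝ) := by exact_mod_cast hb
        _ ≤ _ := hB.1
    · calc (e.tMinus : ℝ) = ((e.tMinus : ℤ) : ℝ) := by push_cast; rfl
        _ ≤ (C.lo : ℝ) := by exact_mod_cast hc
        _ ≤ _ := hC.1
  · exact absurd h2 Bool.false_ne_true

/-- A `T`-checked table chunk has valid entries. [cite: LuZamanZhao2026, §2.2 and (2.3)] -/
theorem entryValid_of_tableCheckT {R : MI} (hR : MI.mem SC (rOf 1.6) R) :
    ∀ {T : List PRow}, tableCheckT R T = true → ∀ e ∈ T, EntryValid e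
  | [], _ => by simp
  | e :: T, h => by
    unfold tableCheckT at h
    rw [Bool.and_eq_true] at h
    intro e' he'
    rcases List.mem_cons.1 he' with rfl | hm
    · exact entryValid_of_entryCheckT hR h.1
    · exact entryValid_of_tableCheckT hR h.2 e' hm

/-- Entrywise validity of a table chunk from its `T`-check in the `match rI` form used by the table files.
[cite: LuZamanZhao2026, §2.2 and (2.3)] -/
theorem entryValid_of_chunkT {T : List PRow}
    (h : (match rI with | some R => tableCheckT R T | none => false) = true) : ∀ e ∈ T, EntryValid e := by
  split at h
  · rename_i R hR
    exact entryValid_of_tableCheckT (mem_rI hR) h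
  · exact absurd h Bool.false_ne_true

end Replay
end LuZamanZhao2026
end Literature.NumberTheory.LFunctions
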